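import Summits.QuantumFields.BalabanUV.T4Continuum.Support.ShellMeasureAveragePathMass

/-!
# Bałaban's renormalization group for 4-d lattice Yang–Mills — B7 Proposition 5, **(139) AT A GENERAL REGULAR
# BACKGROUND IN MAJORANT FORM**: `|(Q(V₀)A)_c| ≤ (Q|A|)_c + C′₁L²α₀(Q″|A|)_c` with print's POSITIVE OPERATORS `Q`
# ([2] (1.11)) and `Q″` ((140)) = `B7BlockGeometry.Qav L` ∕ `Qdd L` acting on the bond function `|A_b|`, and
# `C′₁ = C′₁(d, L) = 1600(d+1)(d+4)L^{d−1}` explicit (`ShellMeasureAverageMajorant`; cell `pub-balaban`, sub-cell `t4`, NE7c ROUND-2 crew row S68 (a), file 2∕2)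

PLACEMENT.  OUR bookkeeping proof of a printed inequality over the tree's kernel objects ⇒ `Summits/…/Support/` (placement rule
2026-08-19; file 1 = `ShellMeasureAveragePathMass`); (139)∕(140) enter as `[cite:]` LOCATORS in the docstrings of the
statements that reproduce their SHAPE — nothing printed is asserted (ABSOLUTE RULE: the paper is under adjudication).  Seat
`b2b-balaban-t4-ne7c-formalise-leaf-05` gen 7; owner table row S68 (a) «[B7] PROP. 5 — (139) IN MAJORANT FORM AT A GENERAL
REGULAR BACKGROUND», booked by owner gen 30 on leaf-10-g9's Proposition-5 cut).  Source: T. Bałaban, *Averaging operations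
for lattice gauge theories*, Commun. Math. Phys. **98**, 17–51 (1985) [Balaban1985Averaging] (cell paper B7; journal page =
PDF page + 16), p. 39 [PDF 23] ((139)–(140)), quoted from the page render
`b2b-balaban-ref1/pages/1985-cmp98-averaging/1985-cmp98-averaging-p023-x2.png` READ AS AN IMAGE by this seat (2026-08-20);
(124)–(126) p. 36, (115) p. 34, (14) p. 19 through the lineage's quotations (`B7Prop3GeneralLinearBound`,
`B7Prop3GeneralLinearSplit`, `B7Prop1Explicit`); [2] = T. Bałaban, *Propagators and renormalization transformations for
lattice gauge theories. I*, Commun. Math. Phys. **95**, 17–40 (1984) [Balaban1984PropagatorsI], (1.8)∕(1.11) p. 19 through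
`B7BlockGeometry`'s quotation.

THE PRINTED TEXT (verbatim, p. 39).  "We would like to prove that the functional derivative of Q_k(U₀, ηA) is bounded
by a constant independent of η. This property is not clear even for the linear part of Q_k, so let us start with an
analysis of this linear part. The linear part of the one-step renormalization transformation is given by the formula
(124). It is a sum of the main term Q_{V₀}A given by (125) and a remainder which we will denote by Q″(V₀)A. From (124) it
is clear that we have the inequalities |Q_{V₀}A| ≦ Q|A|, |Q″(V₀)A| ≦ C′₁L²α₀Q″|A|, (139) where the operator Q is defined as
in [2], and Q″ is defined as (Q″A)_c = Σ_{b⊂B(c₋)∪B(c₊)} L^{−d}A_b. (140) The constant C′₁ depends on d and L."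

DICTIONARY (as in the S55 files and `B7BlockGeometry`).  «L(Q(V₀)A)_c» = `B7Prop3GeneralLinear.linQcov L V₀ A q κ`
(so print's `(Q(V₀)A)_c = L⁻¹·linQcov`), main term `L·(Q₀A)_c = (L : ℝ) • Q0cov` (125); coarse bond `c = (y, κ) : ZdEdge d`
with fine corner `q = blockBase L y`; `Q = Qav L`, `Q″ = Qdd L` on `ZdEdge d → ℝ`, `|A| = fun b ↦ ‖A b.1 b.2‖`; the loop
smallness `|Y_x| = O(L²α₀)` ↦ `‖W_x(V₀) − 1‖ ≤ ε ≤ 1∕8` (`= 16(d+1)(d+4)L²α₀` under (109), Prop. 1).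

WHAT THIS FILE PROVES (kernel, no `sorry`; hypotheses ONLY the displayed `U1` ∕ `ε` ∕ `α₀` binders):
§0 `sum_blockSites_eq_sum_boxVec` (b07's corner indexing ↔ `QuantumLattice.blockSites`), **`sum_pmass_seg_eq_Qav`**
(`Σ_x L^{−(d+1)}Σ_{b⊂[x,x(c)]}|A_b| = (Q|A|)_c` EXACTLY, [2] (1.11)); §1 **`norm_Aloop_le_mass`** (`‖A_x^{(1)}‖ ≤ 4·Σ_{b⊂B(c₋)∪B(c₊)}|A_b|`
by (115)), **`norm_Q0cov_le_Qav`** = (139)'s FIRST HALF «|Q_{V₀}A| ≦ Q|A|»; §2 the three defect brackets of (124) with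
masses (`80ε`, `10ε`, `10ε` × the two-block mass; the operator defects of `B7Prop3GeneralLinearBound` BY NAME),
**`norm_linQcov_sub_main_le_mass`**: `‖L(Q(V₀)A)_c − L·(Q₀A)_c‖ ≤ 100·ε·Lᵈ·(Q″|A|)_c` = (139)'s SECOND HALF; §3
**`norm_linQcov_le_majorant`** (loop regime) and **`norm_linQcov_le_majorant_of_plaquettes`**: under (109) (`512(d+1)(d+4)L²α₀
≤ 1`, `16(d+1)(d+4)L²α₀ ≤ 1∕8`), `‖L(Q(V₀)A)_c‖ ≤ L·(Q|A|)_c + 1600(d+1)(d+4)L^{d+2}α₀·(Q″|A|)_c` — (139) VERBATIM SHAPE with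
`C′₁ = 1600(d+1)(d+4)L^{d−1}` («The constant C′₁ depends on d and L»); §4 **`qcov_le_majorant`**: the pointwise bond-function
inequality `(c ↦ L⁻¹‖L(Q(V₀)A)_c‖) ≤ Qav L |A| + (100εLᵈ∕L) • Qdd L |A|` — LITERALLY the `h139` input of
`B7BlockGeometry.ineq143_succ_lattice` (row S68 (c)'s consumer shape), for a background with `ε`-regular block loops.
ABSOLUTE-RULE LEDGER.  No `B7.Prop*` placeholder, no Literature `Prop`-fact, nothing of the manuscript cited as a fact; no
new definition; `B7.Prop5Printed` neither used nor claimed ((148)∕(149)∕(157) are rows S68 (b)(c)).  DIVERGENCES: `C′₁`'s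
value is an admissible witness, not optimal (loop multiplicities bounded by `4`); loop regime `ε ≤ 1∕8` (lineage's);
everything × `L`; `ℤᵈ`, corner blocks, `U1` background as in `B7BlockGeometry` ∕ b07.  FINDING: (139) holds as printed at a
general regular background with EXACTLY print's `Q`, `Q″` — «From (124) it is clear» = frame cancellation + `[operator − 1]`
factors + every contour of (124) being a monotone walk in `B(c₋) ∪ B(c₊)`.
HONEST FRAMING (cell).  A LITERATURE REPRODUCTION feeding the NE7c ROUND-2 crew's row S68 (a) (owner table
`t4/b2b-balaban-t4-ne7c-p1/LEAVES-NE7c-P1.md`; W-a (Cf′) input of [Balaban1985Variational] (72)→(73)); nothing of Bałaban's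
live-level estimates is discharged; NE7c NOT PRINTED, NOT PROVED; spine PROVED 0∕9; rung (B)+1 on a finite T⁴ — NOT
infinite volume, NOT mass gap, NOT Clay.  HONEST DEPENDENCY: continuum YM on T⁴ ⇐ BetaPertH ∧ nine spine estimates (0/9
proved); BetaPertH ⇐ (D1) ∧ (D4) ∧ CAP+tail; G-an2-4 gates asym, D1 and NE2/3/4.
-/

noncomputable section

open scoped BigOperators
open NormedSpace Finset

namespace Summit.QuantumFields.BalabanUV.T4Continuum.ShellMeasureAverageMajorant

open Literature.MathematicalPhysics.QuantumFieldTheory.Balaban1983to89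

open Literature.MathematicalPhysics.QuantumLattice (ZdEdge blockBase blockSites)
open B7BlockGeometry (Qav_apply)
open B7Prop1Explicit B7Prop3Flat B7Eq92Concrete MatrixLog B7Prop3GeneralRotated B7Prop3GeneralLinear
  B7Prop3GeneralTild B7Prop3GeneralLinearSplit B7Prop3GeneralLinearBound
open ShellMeasureAveragePathMass
open B7Eq78Linearization (conjR conjR_apply conjR_sub conjR_one)
open B12AverageCorridor267 (Dmlog PhiY PhiY_apply expU)
open B7BlockGeometry (Qav Qdd qppBonds)

-- `Site` alone would resolve to the torus sites of `Setup.lean`; re-export the `ℤ^d` sites of `B7Prop1Explicit`.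
export B7Prop1Explicit (Site)

variable {d : ℕ}

variable {𝔸 : Type*} [NormedRing 𝔸] [NormedAlgebra ℂ 𝔸] [NormOneClass 𝔸] [CompleteSpace 𝔸]
variable (L : ℕ)

/-! ## §0 From the corner-block indexing `x = L·y + r` of the b07 lineage to `B7BlockGeometry`'s `blockSites` -/
section Reindex
omit [NormedAlgebra ℂ 𝔸] [NormOneClass 𝔸] [CompleteSpace 𝔸] in

/-- Reindexing a block sum: `Σ_{x ∈ B(y)} g(x) = Σ_{r ∈ [0,L)ᵈ} g(L·y + r)`. [folklore] -/
theorem sum_blockSites_eq_sum_boxVec (hL : 0 < L) {M : Type*} [AddCommMonoid M] (g : Site d → M) (y : Site d) :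
    ∑ x ∈ blockSites L y, g x = ∑ r : Fin d → Fin L, g (blockBase L y + boxVec L r) := by
  have hinj : Set.InjOn (fun t : Fin d → ℕ => blockBase L y + fun i => (t i : ℤ))
      ↑(Fintype.piFinset fun _ : Fin d => range L) := by
    intro t _ t' _ h
    funext i
    have := congr_fun h i
    simp only [Pi.add_apply, add_right_inj, Nat.cast_inj] at this
    exact this
  rw [blockSites, sum_image hinj]
  symm
  refine sum_nbij' (fun r : Fin d → Fin L => fun k => (r k : ℕ)) (fun t k => ⟨t k % L, Nat.mod_lt _ hL⟩) ?_ ?_ ?_ ?_ ?_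
  · intro r _
    exact Fintype.mem_piFinset.2 fun k => mem_range.2 (r k).isLt
  · intro t _
    exact mem_univ _
  · intro r _
    funext k
    exact Fin.ext (Nat.mod_eq_of_lt (r k).isLt)
  · intro t ht
    funext k
    exact Nat.mod_eq_of_lt (mem_range.1 (Fintype.mem_piFinset.1 ht k))
  · intro r _
    rfl

omit [NormedAlgebra ℂ 𝔸] [NormOneClass 𝔸] [CompleteSpace 𝔸] in
/-- **THE MAIN TERM'S MAJORANT IS PRINT'S `Q`**: `Σ_{x∈B(c₋)} L^{−(d+1)} Σ_{b⊂[x,x(c)]} |A_b| = (Q|A|)_c` with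
`B7BlockGeometry.Qav` ([2] (1.11)). [cite: Balaban1985Averaging, (139) p.39; Balaban1984PropagatorsI, (1.11) p.19] -/
theorem sum_pmass_seg_eq_Qav (hL : 0 < L) (A : Site d → Fin d → 𝔸) (y : Site d) (κ : Fin d) :
    ∑ r : Fin d → Fin L, ((L : ℝ) ^ (d + 1))⁻¹ * pmass A (blockBase L y + boxVec L r) (seg κ (L : ℤ)) =
      Qav L (fun b => ‖A b.1 b.2‖) (y, κ) := by
  rw [Qav_apply, sum_blockSites_eq_sum_boxVec L hL]
  refine sum_congr rfl fun r _ => ?_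
  rw [seg_natCast, pmass_replicate, mul_sum]
  refine sum_congr rfl fun l _ => ?_
  rw [zsmul_e]

end Reindex
/-! ## §1 The loop functional `A_x^{(1)}` and the pieces of (124) are majorised by the two-block mass -/

section Pieces
omit [NormOneClass 𝔸] [CompleteSpace 𝔸] in
/-- weighted block sums: `‖Σ_x L^{−d}f_x‖ ≤ Σ_x L^{−d}‖f_x‖`. [folklore] -/
theorem norm_wsum_le_wsum {f : (Fin d → Fin L) → 𝔸} :
    ‖∑ r : Fin d → Fin L, (((L : ℝ) ^ d)⁻¹) • f r‖ ≤ ∑ r : Fin d → Fin L, ((L : ℝ) ^ d)⁻¹ * ‖f r‖ := by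
  refine norm_sum_le_of_le _ fun r _ => ?_
  rw [norm_smul, Real.norm_of_nonneg (by positivity)]

variable {V₀ : Site d → Fin d → 𝔸ˣ} (hV₀ : ∀ x κ, V₀ x κ ∈ U1 𝔸) (A : Site d → Fin d → 𝔸) (hL : 1 ≤ L) (y : Site d)
  (κ : Fin d)

omit [NormedAlgebra ℂ 𝔸] [CompleteSpace 𝔸] in
include hV₀ hL in
/-- **`‖A_x^{(1)}‖ ≤ 4·Σ_{b⊂B(c₋)∪B(c₊)}|A_b|`**: by (115) (`Aloop_eq`) the loop functional is the sum of four rotated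
contour sums — the tree contours `Γ_{c₋,x}`, `Γ_{c₊,x′}`, the segment `[x, x′]` and the bond `c` — each majorised by its
mass (`norm_tsum_le_pmass`) and each living in the two blocks. [cite: Balaban1985Averaging, (115) p.34, (139)-(140) p.39] -/
theorem norm_Aloop_le_mass (r : Fin d → Fin L) :
    ‖Aloop L V₀ A (blockBase L y) κ (boxVec L r)‖ ≤ 4 * ∑ b ∈ qppBonds L (y, κ), ‖A b.1 b.2‖ := by
  have hL' : 0 < L := hL
  set S := ∑ b ∈ qppBonds L (y, κ), ‖A b.1 b.2‖
  have h1 : ‖tsum V₀ A (blockBase L y) (treeWord (boxVec L r))‖ ≤ S :=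
    (norm_tsum_le_pmass hV₀ A _ _).trans (pmass_treeWord_le L hL' A y κ r)
  have h2 : ‖conjR (hol V₀ (blockBase L y) (treeWord (boxVec L r)))
      (tsum V₀ A (blockBase L y + boxVec L r) (seg κ L))‖ ≤ S :=
    (norm_conjR_le (hol_mem hV₀ _ _) _).trans ((norm_tsum_le_pmass hV₀ A _ _).trans
      (pmass_seg_le L hL' A κ (blockBase_add_boxVec_mem L hL' y r)))
  have h3 : ‖conjR (hol V₀ (blockBase L y) (gammaWord L κ (boxVec L r)))
      (tsum V₀ A (blockBase L y + (L : ℤ) • e κ) (treeWord (boxVec L r)))‖ ≤ S :=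
    (norm_conjR_le (hol_mem hV₀ _ _) _).trans ((norm_tsum_le_pmass hV₀ A _ _).trans
      (pmass_treeWord_le' L hL' A y κ r))
  have h4 : ‖conjR (Wcx L V₀ (blockBase L y) κ (boxVec L r)) (tsum V₀ A (blockBase L y) (seg κ L))‖ ≤ S :=
    (norm_conjR_le (Wcx_mem L hV₀ _ κ _) _).trans ((norm_tsum_le_pmass hV₀ A _ _).trans
      (pmass_seg_le L hL' A κ (blockBase_mem L hL' y)))
  rw [Aloop_eq]
  have e1 := norm_sub_le (tsum V₀ A (blockBase L y) (treeWord (boxVec L r))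
    + conjR (hol V₀ (blockBase L y) (treeWord (boxVec L r))) (tsum V₀ A (blockBase L y + boxVec L r) (seg κ L))
    - conjR (hol V₀ (blockBase L y) (gammaWord L κ (boxVec L r)))
        (tsum V₀ A (blockBase L y + (L : ℤ) • e κ) (treeWord (boxVec L r))))
    (conjR (Wcx L V₀ (blockBase L y) κ (boxVec L r)) (tsum V₀ A (blockBase L y) (seg κ L)))
  have e2 := norm_sub_le (tsum V₀ A (blockBase L y) (treeWord (boxVec L r))
    + conjR (hol V₀ (blockBase L y) (treeWord (boxVec L r))) (tsum V₀ A (blockBase L y + boxVec L r) (seg κ L)))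
    (conjR (hol V₀ (blockBase L y) (gammaWord L κ (boxVec L r)))
        (tsum V₀ A (blockBase L y + (L : ℤ) • e κ) (treeWord (boxVec L r))))
  have e3 := norm_add_le (tsum V₀ A (blockBase L y) (treeWord (boxVec L r)))
    (conjR (hol V₀ (blockBase L y) (treeWord (boxVec L r))) (tsum V₀ A (blockBase L y + boxVec L r) (seg κ L)))
  linarith

omit [NormedAlgebra ℂ 𝔸] [CompleteSpace 𝔸] in
include hV₀ hL in
/-- `‖(R_{0,c₋}A)(c)‖ ≤ Σ_{b⊂B(c₋)∪B(c₊)}|A_b|` (the bond `c` is the segment from the corner `c₋`). [cite: Balaban1985Averaging, (139)-(140) p.39] -/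
theorem norm_tsum_bond_le_mass :
    ‖tsum V₀ A (blockBase L y) (seg κ L)‖ ≤ ∑ b ∈ qppBonds L (y, κ), ‖A b.1 b.2‖ :=
  (norm_tsum_le_pmass hV₀ A _ _).trans (pmass_seg_le L hL A κ (blockBase_mem L hL y))

omit [NormedAlgebra ℂ 𝔸] [CompleteSpace 𝔸] in
include hV₀ hL in
/-- `‖R(V₀(c))(R_{0,c₊}A)(Γ_{c₊,x′})‖ ≤ Σ_{b⊂B(c₋)∪B(c₊)}|A_b|`. [cite: Balaban1985Averaging, (139)-(140) p.39] -/
theorem norm_tsum_tree'_le_mass (r : Fin d → Fin L) :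
    ‖conjR (hol V₀ (blockBase L y) (seg κ L)) (tsum V₀ A (blockBase L y + (L : ℤ) • e κ) (treeWord (boxVec L r)))‖
      ≤ ∑ b ∈ qppBonds L (y, κ), ‖A b.1 b.2‖ :=
  (norm_conjR_le (hol_mem hV₀ _ _) _).trans ((norm_tsum_le_pmass hV₀ A _ _).trans
    (pmass_treeWord_le' L hL A y κ r))

omit [CompleteSpace 𝔸] in
include hV₀ hL in
/-- **THE MAIN TERM (125) IS MAJORISED BY `Q|A|`** ((139), first half): `‖(Q₀A)_c‖ ≤ (Q|A|)_c` with `Q = B7BlockGeometry.Qav L`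
([2] (1.11)) acting on the bond function `b ↦ |A_b|` — each rotated segment sum `≤` the segment's mass, summed with the
weights `L^{−(d+1)}`. [cite: Balaban1985Averaging, (139) p.39, (125) p.36] -/
theorem norm_Q0cov_le_Qav :
    ‖Q0cov L V₀ A (blockBase L y) κ‖ ≤ Qav L (fun b => ‖A b.1 b.2‖) (y, κ) := by
  have hL' : 0 < L := hL
  rw [← sum_pmass_seg_eq_Qav L hL' A y κ, Q0cov]
  refine norm_sum_le_of_le _ fun r _ => ?_
  rw [norm_smul, Real.norm_of_nonneg (by positivity)]
  exact mul_le_mul_of_nonneg_left ((norm_conjR_le (hol_mem hV₀ _ _) _).trans (norm_tsum_le_pmass hV₀ A _ _))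
    (by positivity)

end Pieces
/-! ## §2 The three defect brackets of (124) with masses: `O(ε)·Σ_{b⊂B(c₋)∪B(c₊)}|A_b|` -/

section Brackets
variable {V₀ : Site d → Fin d → 𝔸ˣ} (hV₀ : ∀ x κ, V₀ x κ ∈ U1 𝔸) (A : Site d → Fin d → 𝔸) (hL : 1 ≤ L) (y : Site d)
  (κ : Fin d) {ε : ℝ} (hε0 : 0 ≤ ε) (hε : ε ≤ 1 / 8)
  (hW : ∀ r : Fin d → Fin L, ‖((Wcx L V₀ (blockBase L y) κ (boxVec L r) : 𝔸ˣ) : 𝔸) - 1‖ ≤ ε)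

include hV₀ hL hε0 hε hW in
/-- FIRST BRACKET with masses: `‖Φ(Σ_x L^{−d}Ψ_x(A_x^{(1)})) − Σ_x L^{−d}A_x^{(1)}‖ ≤ 80·ε·Σ_{b⊂B(c₋)∪B(c₊)}|A_b|`
(`20ε` times the uniform loop bound `4·Σ|A_b|`). [cite: Balaban1985Averaging, (124)–(126) p.36, (139) p.39] -/
theorem norm_bracket1_le_mass :
    ‖PhiY (Xavg L V₀ (blockBase L y) κ) (DXavg L V₀ A (blockBase L y) κ)
        - ∑ r : Fin d → Fin L, (((L : ℝ) ^ d)⁻¹) • Aloop L V₀ A (blockBase L y) κ (boxVec L r)‖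
      ≤ 80 * ε * ∑ b ∈ qppBonds L (y, κ), ‖A b.1 b.2‖ := by
  set q := blockBase L y with hq
  set ℓ : ℝ := 4 * ∑ b ∈ qppBonds L (y, κ), ‖A b.1 b.2‖ with hℓ
  have hℓ0 : 0 ≤ ℓ := by positivity
  have hX := norm_Xavg_le L hL V₀ q κ hε hW
  have hAl : ∀ r, ‖Aloop L V₀ A q κ (boxVec L r)‖ ≤ ℓ := fun r => norm_Aloop_le_mass L hV₀ A hL y κ r
  set S := ∑ r : Fin d → Fin L, (((L : ℝ) ^ d)⁻¹) • Aloop L V₀ A q κ (boxVec L r) with hS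
  have hin : ‖DXavg L V₀ A q κ - S‖ ≤ 6 * ε * ℓ := by
    rw [hS, DXavg, ← Finset.sum_sub_distrib]
    simp_rw [← smul_sub]
    refine norm_wsum_le L hL fun r => ?_
    refine (norm_Dmlog_mul_right_sub_self_le (Wcx_mem L hV₀ q κ _) hε0 hε (hW r) _).trans ?_
    exact mul_le_mul_of_nonneg_left (hAl r) (by positivity)
  have hSn : ‖S‖ ≤ ℓ := norm_wsum_le L hL hAl
  have hDX : ‖DXavg L V₀ A q κ‖ ≤ 6 * ε * ℓ + ℓ := by
    have h := norm_add_le (DXavg L V₀ A q κ - S) S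
    rw [sub_add_cancel] at h
    linarith
  have hΦ := norm_PhiY_sub_self_le hX hε (DXavg L V₀ A q κ)
  have key : ‖PhiY (Xavg L V₀ q κ) (DXavg L V₀ A q κ) - S‖ ≤ 8 * ε * (6 * ε * ℓ + ℓ) + 6 * ε * ℓ := by
    have h := norm_add_le (PhiY (Xavg L V₀ q κ) (DXavg L V₀ A q κ) - DXavg L V₀ A q κ) (DXavg L V₀ A q κ - S)
    rw [sub_add_sub_cancel] at h
    have h8 : 8 * ε * ‖DXavg L V₀ A q κ‖ ≤ 8 * ε * (6 * ε * ℓ + ℓ) := mul_le_mul_of_nonneg_left hDX (by positivity)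
    linarith
  have h8 : 8 * ε ≤ 1 := by linarith
  have h6 : 0 ≤ 6 * ε * ℓ := by positivity
  have hε2 : 8 * ε * (6 * ε * ℓ) ≤ 6 * ε * ℓ := by
    calc 8 * ε * (6 * ε * ℓ) ≤ 1 * (6 * ε * ℓ) := mul_le_mul_of_nonneg_right h8 h6
      _ = 6 * ε * ℓ := one_mul _
  have e : 8 * ε * (6 * ε * ℓ + ℓ) = 8 * ε * (6 * ε * ℓ) + 8 * ε * ℓ := by ring
  calc ‖PhiY (Xavg L V₀ q κ) (DXavg L V₀ A q κ) - S‖ ≤ 8 * ε * (6 * ε * ℓ + ℓ) + 6 * ε * ℓ := key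
    _ ≤ 20 * ε * ℓ := by rw [e]; linarith
    _ = 80 * ε * ∑ b ∈ qppBonds L (y, κ), ‖A b.1 b.2‖ := by rw [hℓ]; ring

include hV₀ hL hε0 hε hW in
/-- SECOND BRACKET with masses: `‖[𝒜 − Σ_x L^{−d}R(W_x)]((R_{0,c₋}A)(c))‖ ≤ 10·ε·Σ_{b⊂B(c₋)∪B(c₊)}|A_b|`.
[cite: Balaban1985Averaging, (124)–(126) p.36, (139) p.39] -/
theorem norm_bracket2_le_mass :
    ‖conjR (expUnit (Xavg L V₀ (blockBase L y) κ)) (tsum V₀ A (blockBase L y) (seg κ L))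
        - ∑ r : Fin d → Fin L, (((L : ℝ) ^ d)⁻¹) •
            conjR (Wcx L V₀ (blockBase L y) κ (boxVec L r)) (tsum V₀ A (blockBase L y) (seg κ L))‖
      ≤ 10 * ε * ∑ b ∈ qppBonds L (y, κ), ‖A b.1 b.2‖ := by
  set q := blockBase L y with hq
  set Rc := tsum V₀ A q (seg κ L) with hRc
  have hR : ‖Rc‖ ≤ ∑ b ∈ qppBonds L (y, κ), ‖A b.1 b.2‖ := norm_tsum_bond_le_mass L hV₀ A hL y κ
  have hX := norm_Xavg_le L hL V₀ q κ hε hW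
  have h1 : ‖conjR (expUnit (Xavg L V₀ q κ)) Rc - Rc‖ ≤ 8 * ε * ‖Rc‖ := norm_conjR_expUnit_sub_self_le hX hε Rc
  have h2 : ‖∑ r : Fin d → Fin L, (((L : ℝ) ^ d)⁻¹) • conjR (Wcx L V₀ q κ (boxVec L r)) Rc - Rc‖ ≤ 2 * ε * ‖Rc‖ := by
    have e : ∑ r : Fin d → Fin L, (((L : ℝ) ^ d)⁻¹) • conjR (Wcx L V₀ q κ (boxVec L r)) Rc - Rc
        = ∑ r : Fin d → Fin L, (((L : ℝ) ^ d)⁻¹) • (conjR (Wcx L V₀ q κ (boxVec L r)) Rc - Rc) := by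
      simp_rw [smul_sub]
      rw [Finset.sum_sub_distrib, sum_blockWeight (d := d) L hL Rc]
    rw [e]
    exact norm_wsum_le L hL fun r => norm_conjR_sub_self_le (Wcx_mem L hV₀ q κ _) (hW r) Rc
  have h := norm_sub_le (conjR (expUnit (Xavg L V₀ q κ)) Rc - Rc)
    (∑ r : Fin d → Fin L, (((L : ℝ) ^ d)⁻¹) • conjR (Wcx L V₀ q κ (boxVec L r)) Rc - Rc)
  rw [sub_sub_sub_cancel_right] at h
  have hS0 : 0 ≤ ∑ b ∈ qppBonds L (y, κ), ‖A b.1 b.2‖ := by positivity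
  have h82 : 8 * ε * ‖Rc‖ + 2 * ε * ‖Rc‖ ≤ 10 * ε * ∑ b ∈ qppBonds L (y, κ), ‖A b.1 b.2‖ := by nlinarith
  linarith

include hV₀ hL hε0 hε hW in
/-- THIRD BRACKET with masses: `‖Σ_{x′} L^{−d}[𝒜 − R(W_x)]R(V₀(c))(R_{0,c₊}A)(Γ_{c₊,x′})‖ ≤ 10·ε·Σ_{b⊂B(c₋)∪B(c₊)}|A_b|`.
[cite: Balaban1985Averaging, (124)–(126) p.36, (139) p.39] -/
theorem norm_bracket3_le_mass :
    ‖∑ r : Fin d → Fin L, (((L : ℝ) ^ d)⁻¹) •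
        (conjR (expUnit (Xavg L V₀ (blockBase L y) κ))
            (conjR (hol V₀ (blockBase L y) (seg κ L))
              (tsum V₀ A (blockBase L y + (L : ℤ) • e κ) (treeWord (boxVec L r))))
          - conjR (Wcx L V₀ (blockBase L y) κ (boxVec L r))
            (conjR (hol V₀ (blockBase L y) (seg κ L))
              (tsum V₀ A (blockBase L y + (L : ℤ) • e κ) (treeWord (boxVec L r)))))‖
      ≤ 10 * ε * ∑ b ∈ qppBonds L (y, κ), ‖A b.1 b.2‖ := by
  set q := blockBase L y with hq
  have hX := norm_Xavg_le L hL V₀ q κ hε hW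
  have hS0 : 0 ≤ ∑ b ∈ qppBonds L (y, κ), ‖A b.1 b.2‖ := by positivity
  refine norm_wsum_le L hL fun r => ?_
  set Y := conjR (hol V₀ q (seg κ L)) (tsum V₀ A (q + (L : ℤ) • e κ) (treeWord (boxVec L r))) with hY
  have hYn : ‖Y‖ ≤ ∑ b ∈ qppBonds L (y, κ), ‖A b.1 b.2‖ := norm_tsum_tree'_le_mass L hV₀ A hL y κ r
  have h1 := norm_conjR_expUnit_sub_self_le hX hε Y
  have h2 := norm_conjR_sub_self_le (Wcx_mem L hV₀ q κ (boxVec L r)) (hW r) Y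
  have h := norm_sub_le (conjR (expUnit (Xavg L V₀ q κ)) Y - Y) (conjR (Wcx L V₀ q κ (boxVec L r)) Y - Y)
  rw [sub_sub_sub_cancel_right] at h
  have h82 : 8 * ε * ‖Y‖ + 2 * ε * ‖Y‖ ≤ 10 * ε * ∑ b ∈ qppBonds L (y, κ), ‖A b.1 b.2‖ := by nlinarith
  linarith

include hV₀ hL hε0 hε hW in
/-- **THE REMAINDER OF THE LINEAR PART IS MAJORISED BY THE TWO-BLOCK MASS** ((139), second half, in «L(Q(V₀)A)_c» units):
`‖L(Q(V₀)A)_c − L·(Q₀A)_c‖ ≤ 100·ε·Σ_{b⊂B(c₋)∪B(c₊)}|A_b| = 100·ε·Lᵈ·(Q″|A|)_c` for block loops `‖W_x − 1‖ ≤ ε ≤ 1∕8`.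
[cite: Balaban1985Averaging, (139)-(140) p.39, (124) p.36] -/
theorem norm_linQcov_sub_main_le_mass :
    ‖linQcov L V₀ A (blockBase L y) κ - (L : ℝ) • Q0cov L V₀ A (blockBase L y) κ‖
      ≤ 100 * ε * ∑ b ∈ qppBonds L (y, κ), ‖A b.1 b.2‖ := by
  have hW1 : ∀ r : Fin d → Fin L, ‖((Wcx L V₀ (blockBase L y) κ (boxVec L r) : 𝔸ˣ) : 𝔸) - 1‖ < 1 :=
    fun r => (hW r).trans_lt (by linarith)
  have h1 := norm_bracket1_le_mass L hV₀ A hL y κ hε0 hε hW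
  have h2 := norm_bracket2_le_mass L hV₀ A hL y κ hε0 hε hW
  have h3 := norm_bracket3_le_mass L hV₀ A hL y κ hε0 hε hW
  rw [linQcov_split L hL V₀ A (blockBase L y) κ hW1, add_assoc, add_assoc, add_sub_cancel_left]
  refine (norm_add_le _ _).trans ?_
  refine (add_le_add h1 ((norm_add_le _ _).trans (add_le_add h2 h3))).trans ?_
  linarith

end Brackets
/-! ## §3 (139): `|(Q(V₀)A)_c| ≤ (Q|A|)_c + C′₁L²α₀(Q″|A|)_c` -/

section Majorant
variable {V₀ : Site d → Fin d → 𝔸ˣ} (hV₀ : ∀ x κ, V₀ x κ ∈ U1 𝔸) (A : Site d → Fin d → 𝔸) (hL : 1 ≤ L) (y : Site d)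
  (κ : Fin d) {ε : ℝ} (hε0 : 0 ≤ ε) (hε : ε ≤ 1 / 8)
  (hW : ∀ r : Fin d → Fin L, ‖((Wcx L V₀ (blockBase L y) κ (boxVec L r) : 𝔸ˣ) : 𝔸) - 1‖ ≤ ε)

include hV₀ hL hε0 hε hW in
/-- **(139) IN «L(Q(V₀)A)_c» UNITS, LOOP REGIME**: `‖L(Q(V₀)A)_c‖ ≤ L·(Q|A|)_c + 100·ε·Lᵈ·(Q″|A|)_c` with
`Q = B7BlockGeometry.Qav L`, `Q″ = B7BlockGeometry.Qdd L` acting on `b ↦ |A_b|`, for a `U1` background whose block loops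
at `c` satisfy `‖W_x − 1‖ ≤ ε ≤ 1∕8`. [cite: Balaban1985Averaging, (139)-(140) p.39] -/
theorem norm_linQcov_le_majorant :
    ‖linQcov L V₀ A (blockBase L y) κ‖ ≤
      L * Qav L (fun b => ‖A b.1 b.2‖) (y, κ) + 100 * ε * (L : ℝ) ^ d * Qdd L (fun b => ‖A b.1 b.2‖) (y, κ) := by
  have hL' : 0 < L := hL
  have hmain : ‖(L : ℝ) • Q0cov L V₀ A (blockBase L y) κ‖ ≤ L * Qav L (fun b => ‖A b.1 b.2‖) (y, κ) := by
    rw [norm_smul, Real.norm_of_nonneg (Nat.cast_nonneg L)]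
    exact mul_le_mul_of_nonneg_left (norm_Q0cov_le_Qav L hV₀ A hL y κ) (Nat.cast_nonneg L)
  have h := norm_linQcov_sub_main_le_mass L hV₀ A hL y κ hε0 hε hW
  rw [sum_qppBonds_eq_Qdd L hL' A y κ] at h
  have h' := norm_add_le (linQcov L V₀ A (blockBase L y) κ - (L : ℝ) • Q0cov L V₀ A (blockBase L y) κ)
    ((L : ℝ) • Q0cov L V₀ A (blockBase L y) κ)
  rw [sub_add_cancel] at h'
  linarith

include hV₀ hL in
/-- **(139) FROM THE PLAQUETTE REGULARITY (109)**: if `|V₀(∂p) − 1| ≤ α₀` for all plaquettes with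
`512(d+1)(d+4)L²α₀ ≤ 1`, `16(d+1)(d+4)L²α₀ ≤ 1∕8`, then
`‖L(Q(V₀)A)_c‖ ≤ L·(Q|A|)_c + 1600(d+1)(d+4)·L^{d+2}·α₀·(Q″|A|)_c` — i.e. `|(Q(V₀)A)_c| ≤ (Q|A|)_c + C′₁L²α₀(Q″|A|)_c`
with `C′₁ = 1600(d+1)(d+4)L^{d−1}` («C′₁ depends on d and L»; `B7Prop2Explicit.norm_Wcx_sub_one_le` BY NAME for the
loop regularity). [cite: Balaban1985Averaging, (139)-(140) p.39, (109) p.34] -/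
theorem norm_linQcov_le_majorant_of_plaquettes {α₀ : ℝ} (hα₀ : 0 ≤ α₀)
    (hsmall : 512 * (d + 1) * (d + 4) * (L : ℝ) ^ 2 * α₀ ≤ 1)
    (hsmall' : 16 * (d + 1) * (d + 4) * (L : ℝ) ^ 2 * α₀ ≤ 1 / 8)
    (h44 : ∀ (x : Site d) (κ κ' : Fin d), κ ≠ κ' → ‖((hol V₀ x (plaqWord κ κ') : 𝔸ˣ) : 𝔸) - 1‖ ≤ α₀) :
    ‖linQcov L V₀ A (blockBase L y) κ‖ ≤
      L * Qav L (fun b => ‖A b.1 b.2‖) (y, κ)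
        + 1600 * (d + 1) * (d + 4) * (L : ℝ) ^ (d + 2) * α₀ * Qdd L (fun b => ‖A b.1 b.2‖) (y, κ) := by
  have hWε : ∀ r : Fin d → Fin L,
      ‖((Wcx L V₀ (blockBase L y) κ (boxVec L r) : 𝔸ˣ) : 𝔸) - 1‖ ≤ 16 * (d + 1) * (d + 4) * (L : ℝ) ^ 2 * α₀ :=
    fun r => (B7Prop2Explicit.norm_Wcx_sub_one_le L hL V₀ hV₀ hα₀ hsmall h44 (blockBase L y) κ r).trans
      (le_of_eq (by ring))
  have h := norm_linQcov_le_majorant L hV₀ A hL y κ (by positivity) hsmall' hWε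
  refine h.trans (le_of_eq ?_)
  ring

end Majorant
/-! ## §4 The shape `h139` of `B7BlockGeometry.ineq143_succ_lattice` -/

section Shape
variable {V₀ : Site d → Fin d → 𝔸ˣ} (hV₀ : ∀ x κ, V₀ x κ ∈ U1 𝔸) (A : Site d → Fin d → 𝔸) (hL : 1 ≤ L)
  {ε : ℝ} (hε0 : 0 ≤ ε) (hε : ε ≤ 1 / 8)
  (hW : ∀ (y : Site d) (κ : Fin d) (r : Fin d → Fin L),
    ‖((Wcx L V₀ (blockBase L y) κ (boxVec L r) : 𝔸ˣ) : 𝔸) - 1‖ ≤ ε)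

include hV₀ hL hε0 hε hW in
/-- **(139) AS A POINTWISE INEQUALITY OF BOND FUNCTIONS** — the `h139` input of
`B7BlockGeometry.ineq143_succ_lattice` for B7's own average at a general background with block-loop regularity `ε`
everywhere: `(c ↦ L⁻¹‖L(Q(V₀)A)_c‖) ≤ Qav L |A| + (100·ε·Lᵈ∕L) • Qdd L |A|`. [cite: Balaban1985Averaging, (139)-(140) p.39] -/
theorem qcov_le_majorant :
    (fun c : ZdEdge d => (L : ℝ)⁻¹ * ‖linQcov L V₀ A (blockBase L c.1) c.2‖) ≤
      Qav L (fun b => ‖A b.1 b.2‖) + (100 * ε * (L : ℝ) ^ d / L) • Qdd L (fun b => ‖A b.1 b.2‖) := by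
  intro c
  have hL0 : (0 : ℝ) < L := by exact_mod_cast hL
  have h := norm_linQcov_le_majorant L hV₀ A hL c.1 c.2 hε0 hε (hW c.1 c.2)
  simp only [Pi.add_apply, Pi.smul_apply, smul_eq_mul]
  rw [inv_mul_le_iff₀ hL0]
  refine h.trans (le_of_eq ?_)
  field_simp

end Shape
end Summit.QuantumFields.BalabanUV.T4Continuum.ShellMeasureAverageMajorant

end
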